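import Literature.NumberTheory.GelbartRogawski1991.UnitaryDualPairWeilCoinvariantsReference
import Literature.NumberTheory.GelbartRogawski1991.FiniteAdelicSplittingFinRep
import Literature.NumberTheory.Automorphic.UnitaryGroupDualPairReindex
import HarnessLib

/-!
# A reference section of the finite Weil representation of a unitary dual pair ASSEMBLED FROM LOCAL SPLITTINGS of the big group

Topic `NumberTheory/GelbartRogawski1991`; namespace `Literature.NumberTheory.GelbartRogawski1991.UnitaryDualPair.WeilCoinv`.
KERNEL ONLY: one definition with body (`localRefSection`) and theorems; no record, no named fact, no `sorry`.

[GelbartRogawski1991, §3.1 Prop. 3.1.1 p. 455 L1–3]: «at each place `v` … a homomorphism `s_v : G_v → Mp(W_v)` … the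
product `∏_v s_v` defines the splitting over `G(𝐀_f)`» for the BIG unitary group `G₁ = U(V ⊗ W)`; [Liu2021, App. D §D.1
Steps 1∕2∕3 (l. 5217∕5219∕5221), Def. 4.11 (l. 2092–2096)] builds `ω(μ, ε, χ) := ⊗'_v ω(μ_v, ε_v, χ_v)` from the local
splittings `ι_{μ_v}`.  The tree's `UnitaryDualPairWeilCoinvariantsReference.lean` shows that the finite Weil representation
of the dual pair `U(J_V) × U(J_W)` through an ABSTRACT compatible splitting `s` is a character twist of the one through
ANY finite-adelic reference section `s₀` over the pair's symplectic map.  THIS FILE CONSTRUCTS SUCH AN `s₀` FROM LOCAL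
DATA: a family `𝓢 : FinLocalSplittings` of local splittings of the big group `U(J_{VW})`,
`J_{VW} = reindex e e (J_V ⊗ₖ J_W) = 𝕋_F ⊗ 1` (`𝕋_F = gram F e T_V T_W`), read back on the pair:

  `localRefSection 𝓢 := reindex_e⁻¹ ∘ relabel ∘ 𝓢.finSplitting ∘ finPairEmb : U(J_V)(𝔸_f) × U(J_W)(𝔸_f) →* Mp_ψ(𝕎_{T_V ⊗ T_W})ᶜᵒⁿᵗ`

(`finPairEmb` = the finite-adelic pair embedding `(k, u) ↦ reindex e e (k ⊗ₖ u)` of `UnitaryGroupDualPairReindex`,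
`𝓢.finSplitting` = the place-assembled splitting `g ↦ (ι_𝔸(1,g), 1 ⊗ ⊗'_v ω_v(g_v))` of `FiniteAdelicSplittingAssembly`,
`relabel` = `adelicMpContRelabel` along the Gram identity `adelicGram = gram ⊗ 1` with matrix `C = 1`, `reindex_e⁻¹` =
`(adelicMpContReindex F e _).symm`), and proves:

* `proj_localRefSection` — **`s₀` lies over the pair's symplectic map**: `π(s₀(k,u)) = adelicPairToSymplectic ((1,k) ⊗ (1,u))`
  (the intrinsic form of the hypothesis `hproj` of `UnitaryDualPairWeilCoinvariantsReference`; through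
  `finAdelicToAdelic_finPairEmb`, `coe_adelicToSymplectic_adelicPairEmb`, the tree's `proj_finSplitting`, `proj_relabel`,
  `proj_reindex_symm_eq`); hence `proj_localRefSection_eq` (the relative form against any compatible `s`) and the
  archimedean clause `harch`;
* `finRepMp_localRefSection_apply` — **its finite Weil representation is the place-assembled `Ω = ⊗'_v ω_v` read on the
  pair**: `ω_f^{s₀}(k, u) = R_e⁻¹ ∘ Ω(reindex (k ⊗ u)) ∘ R_e` on `𝒮((𝔸_F^∞)^{N×M})` (`R_e = finSBReindex F e`; from
  `finRepMp_unique`, `omega_reindex_symm_apply`, `omega_relabel`, `omega_finSplitting_tmul`, `piSBReindex_tmul`);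
* `commute_omega_finPairEmb` — the two members of `Ω ∘ finPairEmb` commute.  (Consumer, Liu lane:
  `Liu2021/Def411WeilCarriersIrreducibleOfLocal.lean` — `Ω(s, χ')` is irreducible iff the `U(J_V)(𝔸_f)`-action
  `k ↦ Ω(reindex (k ⊗ 1))` on the `χ''`-coinvariants of `u ↦ Ω(reindex (1 ⊗ u))` is.)

So the irreducibility / `⊗'` questions about `Ω(s, χ)` — in particular [Liu2021, Def. 4.11]'s «irreducible», the binder
`hirr` of the Hodge/COR-CM transposition displays — are now questions about the coinvariants of the PLACE-ASSEMBLED Weil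
representation `𝓢.Omega` of the big group, where `FinLocalSplittings.omega_centralCoinv_isIrreducible`
(`FiniteAdelicWeilCentralCoinvariantsIrreducible.lean`) answers them from local inputs.  Nothing of [Liu2021] or
[GelbartRogawski1991] is asserted; HC_CM is not mentioned by this file.

## References
* [GelbartRogawski1991] S. Gelbart, J. Rogawski, Invent. Math. 105 (1991), §3.1 p. 454 L21–33, Prop. 3.1.1 p. 455 L1–3,
  Remark p. 457 L4–13.
* [Liu2021] Y. Liu, Camb. J. Math. 9 (2021) = arXiv:2102.11518, Def. 4.11 (l. 2092–2096), App. D §D.1 Steps 1∕2∕3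
  (l. 5217∕5219∕5221).
* [Weil1964] A. Weil, Acta Math. 111 (1964), Chap. III n° 37–38 pp. 188–190.
-/

set_option autoImplicit false

noncomputable section

open scoped Matrix Kronecker TensorProduct Classical
open NumberField NumberField.mixedEmbedding IsDedekindDomain
open Literature.NumberTheory.Automorphic Literature.NumberTheory.Automorphic.UnitaryGroup
open Literature.NumberTheory.Weil1964 Literature.RepresentationTheory
open Literature.RepresentationTheory.HeisenbergGroup

namespace Literature.NumberTheory.GelbartRogawski1991.UnitaryDualPair

/-! ## §1 The big form `J_{VW} = reindex e e (J_V ⊗ₖ J_W)` is `gram ⊗ 1` -/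

section BigForm

variable (F E : Type) [Field F] [NumberField F] [Field E] [NumberField E] [Algebra F E] {N M n : ℕ}
  (e : Fin N × Fin M ≃ Fin n) {JV : Matrix (Fin N) (Fin N) E} {JW : Matrix (Fin M) (Fin M) E}
  {TV : Matrix (Fin N) (Fin N) F} {TW : Matrix (Fin M) (Fin M) F}

omit [NumberField F] [NumberField E] in
/-- `reindex e e (J_V ⊗ₖ J_W) = (gram F e T_V T_W) ⊗ 1` for `J_V = T_V ⊗ 1`, `J_W = T_W ⊗ 1`: the big hermitian form is
`F`-rational with Gram matrix `𝕋_F = reindex e e (T_V ⊗ₖ T_W)`. [cite: GelbartRogawski1991, §3.1 p. 454] -/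
theorem reindex_kronecker_eq_gram_map (hJV : JV = TV.map (algebraMap F E)) (hJW : JW = TW.map (algebraMap F E)) :
    Matrix.reindex e e (JV ⊗ₖ JW) = (gram F e TV TW).map (algebraMap F E) := by
  rw [hJV, hJW, kronecker_map_map]
  rfl

omit [NumberField F] in
/-- `gram F e T_V T_W` is symmetric when `T_V`, `T_W` are. [cite: GelbartRogawski1991, §3.1 p. 454] -/
theorem isSymm_gram (hV : TV.IsSymm) (hW : TW.IsSymm) : (gram F e TV TW).IsSymm :=
  isSymm_reindex e (isSymm_kronecker hV hW)

/-- the relabelling hypothesis with matrix `C = 1`: `adelicGram · 1 = gram ⊗ 1`. [cite: GelbartRogawski1991, §3.1 p. 454] -/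
theorem adelicGram_mul_one :
    adelicGram F e TV TW * ((1 : GL (Fin n) (AdeleRing (𝓞 F) F)) : Matrix (Fin n) (Fin n) (AdeleRing (𝓞 F) F)) =
      (gram F e TV TW).map (algebraMap F (AdeleRing (𝓞 F) F)) := by
  rw [Units.val_one, Matrix.mul_one, adelicGram_eq_map]

end BigForm

namespace WeilCoinv

variable (F E : Type) [Field F] [NumberField F] [Field E] [NumberField E] [Algebra F E]
variable (c : E ≃ₐ[F] E) (N M : ℕ) {n : ℕ} (e : Fin N × Fin M ≃ Fin n)
variable (JV : Matrix (Fin N) (Fin N) E) (JW : Matrix (Fin M) (Fin M) E)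
variable {TV : Matrix (Fin N) (Fin N) F} {TW : Matrix (Fin M) (Fin M) F}
variable [Algebra.IsQuadraticExtension F E] {δ : E} (hcδ : c δ = -δ) (hδ : δ ≠ 0) {d : F}
  (hd : δ * δ = algebraMap F E d) (hV : TV.IsSymm) (hW : TW.IsSymm) (hVd : IsUnit TV.det) (hWd : IsUnit TW.det)
  (hJV : JV = TV.map (algebraMap F E)) (hJW : JW = TW.map (algebraMap F E))
/- THE LOCAL DATA: local splittings `s_v : U(J_{VW})(F_v) →* S̃p_{ψ_v}(𝕎_v)` of the BIG group (Liu's `ι_{μ_v}` for the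
hermitian space `V ⊗ W`; [GelbartRogawski1991, Prop. 3.1.1 p. 455 L1–3]). -/
variable (𝓢 : LocalSplitting.FinLocalSplittings F E c n hcδ hδ hd (gram F e TV TW) (isSymm_gram F e hV hW)
  (reindex_kronecker_eq_gram_map F E e hJV hJW))

/-! ## §2 The reference section assembled from local splittings of the big group -/

/-- **`s₀ := reindex_e⁻¹ ∘ relabel ∘ s_f ∘ finPairEmb`**: the finite-adelic pair section obtained by reading the
place-assembled splitting `s_f = 𝓢.finSplitting` of `U(J_{VW})(𝔸_{F,f})` on the dual pair `U(J_V)(𝔸_f) × U(J_W)(𝔸_f)`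
(`(k, u) ↦ reindex e e (k ⊗ₖ u)`) and moving it to the Kronecker-indexed metaplectic group `Mp_ψ(𝕎_{T_V ⊗ T_W})ᶜᵒⁿᵗ` of the
pair's Weil representation (relabelling `gram ⊗ 1 ↔ adelicGram` with `C = 1`, then `reindex_e⁻¹`).
[cite: GelbartRogawski1991, §3.1 Prop. 3.1.1 p. 455 L1–3; Liu2021, App. D §D.1 Steps 1∕2 (l. 5217∕5219)] -/
def localRefSection :
    UnitaryGroup.finAdelic F E c N JV × UnitaryGroup.finAdelic F E c M JW →*
      adelicMpCont F (Fin N × Fin M)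
        (TV.map (algebraMap F (AdeleRing (𝓞 F) F)) ⊗ₖ TW.map (algebraMap F (AdeleRing (𝓞 F) F))) :=
  (adelicMpContReindex F e
      (TV.map (algebraMap F (AdeleRing (𝓞 F) F)) ⊗ₖ TW.map (algebraMap F (AdeleRing (𝓞 F) F)))).symm.toMonoidHom.comp
    ((adelicMpContRelabel F (Fin n) 1 (adelicGram_mul_one F e)).toMonoidHom.comp
      (𝓢.finSplitting.comp (finPairEmb F E c N M e JV JW)))

/-- unfolding on elements. [cite: GelbartRogawski1991, §3.1 Prop. 3.1.1 p. 455 L1–3] -/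
theorem localRefSection_apply (p : UnitaryGroup.finAdelic F E c N JV × UnitaryGroup.finAdelic F E c M JW) :
    localRefSection F E c N M e JV JW hcδ hδ hd hV hW hJV hJW 𝓢 p =
      (adelicMpContReindex F e
          (TV.map (algebraMap F (AdeleRing (𝓞 F) F)) ⊗ₖ TW.map (algebraMap F (AdeleRing (𝓞 F) F)))).symm
        (adelicMpContRelabel F (Fin n) 1 (adelicGram_mul_one F e) (𝓢.finSplitting (finPairEmb F E c N M e JV JW p))) :=
  rfl

/-! ## §3 `s₀` lies over the pair's symplectic map -/

/-- **`π(relabel(s_f(reindex (k ⊗ u)))) = W_e ∘ adelicPairToSymplectic((1,k) ⊗ (1,u)) ∘ W_e⁻¹`** (before the final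
`reindex_e⁻¹`): `proj_relabel` (with `C = 1` the relabelling is the identity on vectors), `proj_finSplitting`,
`finAdelicToAdelic_finPairEmb`, `coe_adelicToSymplectic_adelicPairEmb`. [cite: GelbartRogawski1991, §3.1 p. 454 L21–33] -/
theorem proj_relabel_finSplitting_finPairEmb (p : UnitaryGroup.finAdelic F E c N JV × UnitaryGroup.finAdelic F E c M JW) :
    adelicMpCont.proj F (Fin n) _
        (adelicMpContRelabel F (Fin n) 1 (adelicGram_mul_one F e) (𝓢.finSplitting (finPairEmb F E c N M e JV JW p))) =
      spReindex e _ (UnitaryGroup.adelicPairToSymplectic F E c N M hcδ hδ hd hV hW hJV hJW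
        (dualPair (UnitaryGroup.conjAdele F E c) (UnitaryGroup.adelicForm E N JV) (UnitaryGroup.adelicForm E M JW)
          (finPairToAdelic F E c N M JV JW p))) := by
  refine Subtype.ext (LinearEquiv.ext fun v => ?_)
  obtain ⟨k, u⟩ := p
  -- the symplectic component of `s_f (reindex (k ⊗ u))`, as an automorphism of `𝕎_𝔸`, through the embedded element
  have h3 : ((UnitaryGroup.adelicToSymplectic F E c n hcδ hδ hd (isSymm_gram F e hV hW)
          (reindex_kronecker_eq_gram_map F E e hJV hJW)
          (UnitaryGroup.finAdelicToAdelic F E c n (Matrix.reindex e e (JV ⊗ₖ JW))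
            (finPairEmb F E c N M e JV JW (k, u)))).1 :
        ((Fin n → AdeleRing (𝓞 F) F) × (Fin n → AdeleRing (𝓞 F) F)) ≃ₗ[AdeleRing (𝓞 F) F]
          ((Fin n → AdeleRing (𝓞 F) F) × (Fin n → AdeleRing (𝓞 F) F))) =
      ((reindexW (AdeleRing (𝓞 F) F) e).symm.trans
        (UnitaryGroup.adelicPairToSymplectic F E c N M hcδ hδ hd hV hW hJV hJW
          (dualPair (UnitaryGroup.conjAdele F E c) (UnitaryGroup.adelicForm E N JV) (UnitaryGroup.adelicForm E M JW)
            ((UnitaryGroup.finAdelicToAdelic F E c N JV k : UnitaryGroup.adelic F E c N JV),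
              (UnitaryGroup.finAdelicToAdelic F E c M JW u : UnitaryGroup.adelic F E c M JW)))).1).trans
        (reindexW (AdeleRing (𝓞 F) F) e) :=
    (congrArg (fun x : UnitaryGroup.adelic F E c n (Matrix.reindex e e (JV ⊗ₖ JW)) =>
        ((UnitaryGroup.adelicToSymplectic F E c n hcδ hδ hd (isSymm_gram F e hV hW)
            (reindex_kronecker_eq_gram_map F E e hJV hJW) x).1 :
          ((Fin n → AdeleRing (𝓞 F) F) × (Fin n → AdeleRing (𝓞 F) F)) ≃ₗ[AdeleRing (𝓞 F) F]
            ((Fin n → AdeleRing (𝓞 F) F) × (Fin n → AdeleRing (𝓞 F) F))))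
      (finAdelicToAdelic_finPairEmb F E c N M e JV JW k u)).trans
      (coe_adelicToSymplectic_adelicPairEmb F E c N M e JV JW hcδ hδ hd hV hW hJV hJW _ _ _)
  change relabelVec F (Fin n) 1
      ((UnitaryGroup.adelicToSymplectic F E c n hcδ hδ hd (isSymm_gram F e hV hW)
          (reindex_kronecker_eq_gram_map F E e hJV hJW)
          (UnitaryGroup.finAdelicToAdelic F E c n (Matrix.reindex e e (JV ⊗ₖ JW))
            (finPairEmb F E c N M e JV JW (k, u)))).1 ((relabelVec F (Fin n) 1).symm v)) =
    reindexW (AdeleRing (𝓞 F) F) e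
      ((UnitaryGroup.adelicPairToSymplectic F E c N M hcδ hδ hd hV hW hJV hJW
        (dualPair (UnitaryGroup.conjAdele F E c) (UnitaryGroup.adelicForm E N JV) (UnitaryGroup.adelicForm E M JW)
          (finPairToAdelic F E c N M JV JW (k, u)))).1 ((reindexW (AdeleRing (𝓞 F) F) e).symm v))
  rw [h3]
  simp only [LinearEquiv.trans_apply, relabelVec_apply, relabelVec_symm_apply, inv_one, Units.val_one,
    Matrix.one_mulVec, Prod.mk.eta]
  rfl

/-- **`s₀` lies over the pair's symplectic map** (intrinsic form): `π(s₀(k, u)) = adelicPairToSymplectic((1,k) ⊗ (1,u))`.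
[cite: GelbartRogawski1991, §3.1 p. 454 L21–33] -/
theorem proj_localRefSection (p : UnitaryGroup.finAdelic F E c N JV × UnitaryGroup.finAdelic F E c M JW) :
    adelicMpCont.proj F (Fin N × Fin M) _ (localRefSection F E c N M e JV JW hcδ hδ hd hV hW hJV hJW 𝓢 p) =
      UnitaryGroup.adelicPairToSymplectic F E c N M hcδ hδ hd hV hW hJV hJW
        (dualPair (UnitaryGroup.conjAdele F E c) (UnitaryGroup.adelicForm E N JV) (UnitaryGroup.adelicForm E M JW)
          (finPairToAdelic F E c N M JV JW p)) :=
  adelicMpCont.proj_reindex_symm_eq F e _ (proj_relabel_finSplitting_finPairEmb F E c N M e JV JW hcδ hδ hd hV hW hJV hJW 𝓢 p)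

variable {s : UnitaryGroup.adelicPair F E c N M JV JW →* adelicMpCont F (Fin n) (adelicGram F e TV TW)}
  (hs : (splittingDatum F E c N M e JV JW hcδ hδ hd hV hW hVd hWd hJV hJW).IsCompatible s)

include hs in
/-- **the relative form** of `hproj` against ANY compatible splitting `s` of the pair datum:
`π ∘ s₀ = π ∘ (pairSmall₁ s ∘ finPairToAdelic)` (`proj_eq_proj_finPairSection_of_intrinsic`). [cite: GelbartRogawski1991, §3.1 p. 454 L21–33] -/
theorem proj_localRefSection_eq (p : UnitaryGroup.finAdelic F E c N JV × UnitaryGroup.finAdelic F E c M JW) :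
    adelicMpCont.proj F (Fin N × Fin M) _ (localRefSection F E c N M e JV JW hcδ hδ hd hV hW hJV hJW 𝓢 p) =
      adelicMpCont.proj F (Fin N × Fin M) _
        (((pairSmall₁ F E c N M e JV JW s).comp (finPairToAdelic F E c N M JV JW)) p) :=
  proj_eq_proj_finPairSection_of_intrinsic F E c N M e JV JW hcδ hδ hd hV hW hVd hWd hJV hJW _ hs
    (proj_localRefSection F E c N M e JV JW hcδ hδ hd hV hW hJV hJW 𝓢) p

include hs in
/-- the archimedean clause for `s₀` (`harch_reference`). [cite: Weil1964, Chap. III n° 37–38 pp. 188–190] -/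
theorem harch_localRefSection (p : UnitaryGroup.finAdelic F E c N JV × UnitaryGroup.finAdelic F E c M JW)
    (a w : Fin N × Fin M → mixedSpace F) :
    (adelicMpCont.proj F (Fin N × Fin M) _ (localRefSection F E c N M e JV JW hcδ hδ hd hV hW hJV hJW 𝓢 p)).1
        (archVec F (Fin N × Fin M) a, archVec F (Fin N × Fin M) w) =
      (archVec F (Fin N × Fin M) a, archVec F (Fin N × Fin M) w) :=
  harch_reference F E c N M e JV JW hcδ hδ hd hV hW hVd hWd hJV hJW _
    (proj_localRefSection_eq F E c N M e JV JW hcδ hδ hd hV hW hVd hWd hJV hJW 𝓢 hs) hs p a w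

/-! ## §4 The finite Weil representation of `s₀` is `Ω = ⊗'_v ω_v` read on the pair -/

/-- `R_{e⁻¹}^∞ (R_e^∞ φ) = φ`. [cite: Weil1964, Chap. III n° 37–38 pp. 188–190] -/
theorem schwartzReindexCLM_symm_apply (φ : SchwartzMap ((Fin N × Fin M) → mixedSpace F) ℂ) :
    schwartzReindexCLM F e.symm (schwartzReindexCLM F e φ) = φ := by
  ext w
  rw [schwartzReindexCLM_apply, schwartzReindexCLM_apply]
  exact congrArg φ (funext fun i => congrArg w (e.symm_apply_apply i))

/-- `R_{e⁻¹}^f = (R_e^f)⁻¹` on `𝒮((𝔸_F^∞)^ι)`. [cite: Weil1964, Chap. III n° 37–38 pp. 188–190] -/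
theorem finSBReindex_symm_eq : finSBReindex F e.symm = (finSBReindex F e).symm := rfl

/-- `ω(s₀ p) Φ = R_e⁻¹ (ω(relabel (s_f (reindex (k ⊗ u)))) (R_e Φ))` (`omega_reindex_symm_apply`).
[cite: Weil1964, Chap. III n° 37–38 pp. 188–190] -/
theorem omega_localRefSection_apply (p : UnitaryGroup.finAdelic F E c N JV × UnitaryGroup.finAdelic F E c M JW)
    (Φ : piSchwartzBruhat F (Fin N × Fin M)) :
    adelicMpCont.omega F (Fin N × Fin M)
        (TV.map (algebraMap F (AdeleRing (𝓞 F) F)) ⊗ₖ TW.map (algebraMap F (AdeleRing (𝓞 F) F)))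
        (localRefSection F E c N M e JV JW hcδ hδ hd hV hW hJV hJW 𝓢 p) Φ =
      (piSBReindex F e).symm (adelicMpCont.omega F (Fin n) (adelicGram F e TV TW)
        (adelicMpContRelabel F (Fin n) 1 (adelicGram_mul_one F e) (𝓢.finSplitting (finPairEmb F E c N M e JV JW p)))
        (piSBReindex F e Φ)) :=
  adelicMpCont.omega_reindex_symm_apply F e _ _ Φ

/-- `ω(relabel (s_f g')) Ψ = ω(s_f g') Ψ` (`omega_relabel`: the relabelling does not move the operator).
[cite: GelbartRogawski1991, §3.1 p. 454 L21–33] -/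
theorem omega_relabel_finSplitting_apply (g' : UnitaryGroup.finAdelic F E c n (Matrix.reindex e e (JV ⊗ₖ JW)))
    (Ψ : piSchwartzBruhat F (Fin n)) :
    adelicMpCont.omega F (Fin n) (adelicGram F e TV TW)
        (adelicMpContRelabel F (Fin n) 1 (adelicGram_mul_one F e) (𝓢.finSplitting g')) Ψ =
      adelicMpCont.omega F (Fin n) ((gram F e TV TW).map (algebraMap F (AdeleRing (𝓞 F) F))) (𝓢.finSplitting g') Ψ :=
  LinearMap.congr_fun (adelicMpCont.omega_relabel F (Fin n) 1 (adelicGram_mul_one F e) (𝓢.finSplitting g')) Ψ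

include hs in
set_option maxHeartbeats 400000 in
/-- **`ω_f^{s₀}(k, u) f = R_e⁻¹ (Ω(reindex (k ⊗ u)) (R_e f))`** (`R_e = finSBReindex F e`): the finite Weil representation
of the reference section IS the place-assembled `Ω = ⊗'_v ω_v` of the big group read on the pair.
[cite: Weil1964, Chap. III n° 37–38 pp. 188–190; GelbartRogawski1991, §3.1 Prop. 3.1.1 p. 455 L1–3] -/
theorem finRepMp_localRefSection_apply (p : UnitaryGroup.finAdelic F E c N JV × UnitaryGroup.finAdelic F E c M JW)
    (f : FinSB F (Fin N × Fin M)) :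
    finRepMp (isUnit_kronecker_map F N hVd hWd) (localRefSection F E c N M e JV JW hcδ hδ hd hV hW hJV hJW 𝓢)
        (harch_localRefSection F E c N M e JV JW hcδ hδ hd hV hW hVd hWd hJV hJW 𝓢 hs) p f =
      (finSBReindex F e).symm (𝓢.Omega (finPairEmb F E c N M e JV JW p) (finSBReindex F e f)) := by
  -- the candidate finite operator
  let B : FinSB F (Fin N × Fin M) →ₗ[ℂ] FinSB F (Fin N × Fin M) :=
    (finSBReindex F e).symm.toLinearMap ∘ₗ (𝓢.Omega (finPairEmb F E c N M e JV JW p)) ∘ₗ (finSBReindex F e).toLinearMap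
  have hΦ₀ : unitSchwartz F (Fin N × Fin M) ≠ 0 := fun h => by
    have h1 := unitSchwartz_apply_zero (F := F) (ι := Fin N × Fin M)
    rw [h] at h1
    change (0 : ℂ) = 1 at h1
    exact zero_ne_one h1
  have hB : ∀ g : FinSB F (Fin N × Fin M),
      adelicMpCont.omega F (Fin N × Fin M) _ (localRefSection F E c N M e JV JW hcδ hδ hd hV hW hJV hJW 𝓢 p)
          (piSchwartzBruhatEquiv F (Fin N × Fin M) (unitSchwartz F (Fin N × Fin M) ⊗ₜ g)) =
        piSchwartzBruhatEquiv F (Fin N × Fin M) (unitSchwartz F (Fin N × Fin M) ⊗ₜ B g) := fun g => by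
    -- abbreviations
    let g' := finPairEmb F E c N M e JV JW p
    let x := 𝓢.finSplitting g'
    let a := schwartzReindexCLM F e (unitSchwartz F (Fin N × Fin M))
    let b := finSBReindex F e g
    -- `ω(s₀ p) (φ₀ ⊗ g) = R_e⁻¹ (ω(relabel x) (R_e (φ₀ ⊗ g)))`
    refine (omega_localRefSection_apply F E c N M e JV JW hcδ hδ hd hV hW hJV hJW 𝓢 p _).trans ?_
    -- `R_e (φ₀ ⊗ g) = R_e^∞ φ₀ ⊗ R_e^f g`
    refine (congrArg (fun y => (piSBReindex F e).symm (adelicMpCont.omega F (Fin n) (adelicGram F e TV TW)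
      (adelicMpContRelabel F (Fin n) 1 (adelicGram_mul_one F e) x) y))
      (piSBReindex_tmul F e (unitSchwartz F (Fin N × Fin M)) g)).trans ?_
    -- `ω(relabel x) = ω(x)` and `ω(s_f g') (a ⊗ b) = a ⊗ Ω(g') b`
    refine (congrArg (piSBReindex F e).symm ((omega_relabel_finSplitting_apply F E c N M e JV JW hcδ hδ hd hV hW hJV hJW
      𝓢 g' _).trans (𝓢.omega_finSplitting_tmul g' a b))).trans ?_
    -- back along `R_e⁻¹ = R_{e⁻¹}`: `R_{e⁻¹} (a ⊗ Ω b) = R_{e⁻¹}^∞ a ⊗ R_{e⁻¹}^f (Ω b)`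
    refine (piSBReindex_tmul F e.symm a (𝓢.Omega g' b) :
      (piSBReindex F e).symm (piSchwartzBruhatEquiv F (Fin n) (a ⊗ₜ 𝓢.Omega g' b)) = _).trans ?_
    rw [schwartzReindexCLM_symm_apply]
    rfl
  have key := finRepMp_unique (isUnit_kronecker_map F N hVd hWd)
    (localRefSection F E c N M e JV JW hcδ hδ hd hV hW hJV hJW 𝓢)
    (harch_localRefSection F E c N M e JV JW hcδ hδ hd hV hW hVd hWd hJV hJW 𝓢 hs) p hΦ₀ hB
  rw [← key]
  rfl

/-! ## §5 The two members of `Ω ∘ finPairEmb` commute -/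

/-- the `U(J_V)`- and `U(J_W)`-members of the place-assembled `Ω` read on the pair commute (so `U(J_V)(𝔸_f)` acts on the
`χ`-coinvariants of `u ↦ Ω(reindex (1 ⊗ u))`, `TwistedCoinv.rep`). [cite: MoeglinVignerasWaldspurger1987, Chap. 1 I.17] -/
theorem commute_omega_finPairEmb (k : UnitaryGroup.finAdelic F E c N JV) (u : UnitaryGroup.finAdelic F E c M JW) :
    Commute ((show Representation ℂ (UnitaryGroup.finAdelic F E c N JV) _ from
        𝓢.Omega.comp ((finPairEmb F E c N M e JV JW).comp (MonoidHom.inl _ _))) k)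
      ((show Representation ℂ (UnitaryGroup.finAdelic F E c M JW) _ from
        𝓢.Omega.comp ((finPairEmb F E c N M e JV JW).comp (MonoidHom.inr _ _))) u) := by
  change Commute (𝓢.Omega (finPairEmb F E c N M e JV JW (k, 1))) (𝓢.Omega (finPairEmb F E c N M e JV JW (1, u)))
  exact (commute_finPairEmb_inl_inr F E c N M e JV JW k u).map 𝓢.Omega

end WeilCoinv

end Literature.NumberTheory.GelbartRogawski1991.UnitaryDualPair

end
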